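import Literature.NumberTheory.EllipticCurves.BurungaleCastellaSkinner2025.CyclotomicMainTheoremIntegral
import Literature.NumberTheory.EllipticCurves.CyclotomicIwasawaMainTheoremIrreducibleIntegral
import Literature.NumberTheory.EllipticCurves.ModularCurvePeriodRatio
import Literature.NumberTheory.EllipticCurves.KuriharaNumberKimCertificateProofs
import Literature.NumberTheory.EllipticCurves.Rank1Residual.X9SmallImage
import HarnessLib

/-!
# Burungale–Castella–Skinner 2025, Thm. 1.1.2 (b): the tree's TWO transcriptions are one theorem
# (kernel bridges between `thm112b_charIdeal_eq_padicLFunction_integral` and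
# `burungale_castella_skinner_charIdeal_eq_padicLFunction_integral`; theorems only, no new fact)

Topic `Literature/NumberTheory/EllipticCurves`, paper directory `BurungaleCastellaSkinner2025/`;
sibling of `CyclotomicMainTheoremIntegral.lean`. Written by the typer seat `bsd-litref-bcs25-ty`
(cell `pub/bsd-litref/bcs25`, BSD-LIT2PART programme T2) to close the dedup item recorded in its
binder sheet `pub/bsd-litref/bcs25/sheets/bcs25-ty-BINDERS-v1.md` §1 (5) (typer lint rule: "cite an
existing decl rather than restating a near-duplicate"). HONEST FRAMING: nothing here proves a
published theorem or moves a census cell; the file proves that two NAMED FACTS of the tree which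
transcribe the SAME printed clause imply each other modulo named facts already in the tree, so that
neither is an independent print dependence of the other's consumers.

## The two transcriptions of Thm. 1.1.2 (b) (IMRN 2025 rnaf082 = arXiv:2405.00270v2, p. 2)

"(b) If in addition there exists an element `σ ∈ G_{ℚ(μ_{p^∞})}` such that `T/(σ − 1)T ≃ ℤ_p`,
(im) then the equality [`ch_Λ(X^ord(E/ℚ_∞)) = (L_p(E/ℚ))`] holds in `Λ`" — with `L_p(E/ℚ)` the
Mazur–Swinnerton-Dyer `p`-adic `L`-function, normalised by the Néron period (p. 1).

* (T1) `BurungaleCastellaSkinner2025.thm112b_charIdeal_eq_padicLFunction_integral`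
  (`CyclotomicMainTheoremIntegral.lean`; registry A148; D-audited VERBATIM by audit-1 §A and by the
  litref readers r1/r2): hypotheses `3 < p`, `GoodOrd`, `Irr`, `BigIm` (= (im) literally), newform
  `f` at level `N_E`, and the conclusion for EVERY rational `ϖ` with `ϖ · Ω_E = Ω⁺_f`:
  `ch_Λ X = (g)`, `ι g = ϖ · L_p(f, α)` (the Néron-normalised `L_p(E/ℚ) = ϖ · L_p(f, α)`).
* (T2) `burungale_castella_skinner_charIdeal_eq_padicLFunction_integral`
  (`CyclotomicIwasawaMainTheoremIrreducibleIntegral.lean`; cell b2b-bsdr2sha): hypotheses `5 ≤ p`,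
  good, ordinary, irreducible, `ρ̄_{E,p^n}` onto for every `n` (a special case of (im)), newform `f`
  at any level `N`, conclusion `ch_Λ X = (g)`, `ι g = L_p(f, α)` — the `Ω⁺_f`-normalised function,
  i.e. the printed conclusion MODULO the sentence "`ϖ = Ω⁺_f/Ω_E` is a `p`-adic unit under (irr_ℚ)"
  asserted in that file's docstring.

## What is proved here, and from what

* `thm112b_of_charIdeal_eq_padicLFunction_integral`: (T2) ∧ `realPeriodRat_eq_unit_mul_plusPeriod`
  ⟹ (T1). Inputs, all tree THEOREMS: (irr) ∧ (im) ⟹ surj(p) (`Rank1Residual.surj_of_irr_of_bigIm`,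
  Serre 1972 Prop. 15 via the transvection criterion); surj(p) ∧ `p ≥ 5` ⟹ every `ρ̄_{E,p^n}` onto
  (`serre_hasSurjectiveModNGaloisRep_pow_holds`, Serre 1968 IV §3.4 Lemma 3); `Ω_E > 0`
  (`WeierstrassCurve.realPeriodRat_pos_holds`), so `ϖ · Ω_E = Ω⁺_f` and `Ω_E = u · Ω⁺_f` force
  `ϖ = u⁻¹`; and the rescaling of a generator by the unit constant `C(u) ∈ Λˣ`
  (`exists_span_eq_and_map_eq_C_inv_mul_iff`). The one named-fact input is the period comparison
  `realPeriodRat_eq_unit_mul_plusPeriod` (`ModularCurvePeriodRatio.lean`: `Ω_E = u · Ω⁺_f`,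
  `|u|_p = 1`, at a good `p ≥ 5` with `E[p]` irreducible — Greenberg–Vatsal 2000 Rem. 3.4 with the
  Manin constant; itself a tree theorem granted Mazur 1978 Cor. 4.1,
  `realPeriodRat_eq_unit_mul_plusPeriod_of_mazur`), which is EXACTLY the docstring sentence of (T2)
  made explicit.
* `charIdeal_eq_padicLFunction_integral_of_thm112b`: (T1) ∧ `realPeriodRat_eq_unit_mul_plusPeriod`
  ∧ Carayol's level theorem (`IsNewformOf.level_eq_conductorNorm`, named fact of `CuspFormLFunction`,
  needed because (T2) quantifies over newforms of any level while (T1) is stated at level `N_E`)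
  ∧ "every `ρ̄_{E,p^n}` onto ⟹ (im)" ⟹ (T2). The last input is the tree THEOREM
  `Summit.BirchSwinnertonDyer.Rank1Residual.X9.bigIm_of_hasSurjectiveModNGaloisRep_pow`
  (`Summits/BirchSwinnertonDyer/Rank1Residual/X9/SurjBigImage.lean`, every prime `p`, standard
  axioms); it is taken here as the hypothesis `hIm` spelled as that theorem's statement ONLY because a
  `Literature` module may not import `Summits` — Summit-side users discharge it by name. It is not a
  named fact and no `def … : Prop` is introduced for it.

So, over the tree: (T1) ⟸ (T2) granted one named fact (GV00 Rem. 3.4 / Mazur 1978 Cor. 4.1), and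
(T2) ⟸ (T1) granted that fact, Carayol, and a kernel theorem. Registry consequence (for
pub-bsdpct/CITED-FACTS.md, rows A148 and the b2b-bsdr2sha `_integral` row): the two rows are ONE
print dependence (BCS25 Thm. 1.1.2 (b)) plus the period-ratio row, not two. PARTITION: 0 classes
move (bookkeeping between named facts); BSD is not proved by any of this.

## References

* [BurungaleCastellaSkinner2025] A. Burungale, F. Castella, C. Skinner, IMRN 2025 rnaf082 =
  arXiv:2405.00270v2: Thm. 1.1.2 (b) and (im) (p. 2), `L_p(E/ℚ)` of Mazur–Swinnerton-Dyer (p. 1).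
* [GreenbergVatsal2000] R. Greenberg, V. Vatsal, Invent. Math. 142 (2000), §3, Remark 3.4 (the
  period ratio is a `p`-adic unit when `E[p]` is irreducible and `p ∤ N`).
* [Mazur1978] B. Mazur, Invent. Math. 44 (1978), Cor. 4.1 (Manin constant at odd `p`, `p² ∤ 4N`).
* [Carayol1986] H. Carayol, Ann. Sci. ÉNS 19 (1986) (level of the newform = conductor).
* [SerreAbelianLadic1968] J.-P. Serre, *Abelian `ℓ`-adic representations* (1968), IV §3.4 Lemma 3;
  [Serre1972] Invent. Math. 15 (1972), §2.4 Prop. 15.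
-/

set_option autoImplicit false

noncomputable section

open scoped Classical MatrixGroups ModularForm

open CongruenceSubgroup WeierstrassCurve Literature.NumberTheory.EllipticCurves
  Literature.NumberTheory.EllipticCurves.ModularForms Literature.NumberTheory.EllipticCurves.Rank1Residual

namespace Literature.NumberTheory.EllipticCurves.BurungaleCastellaSkinner2025

/-- A prime `p > 3` is `≥ 5`. [folklore] -/
private theorem five_le_of_three_lt_of_prime {p : ℕ} (hp : p.Prime) (h3 : 3 < p) : 5 ≤ p := by
  by_contra h
  have h4 : p = 4 := by omega
  exact absurd (h4 ▸ hp) (by decide)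

/-- **The period witness pins `ϖ`.** If `Ω_E = u · Ω⁺_f` with `Ω_E > 0` (tree theorem
`WeierstrassCurve.realPeriodRat_pos_holds`) and `ϖ · Ω_E = Ω⁺_f`, then `ϖ = u⁻¹`. [folklore] -/
private theorem ratio_eq_inv_of_realPeriodRat_eq (W : WeierstrassCurve ℚ) [W.IsElliptic]
    {N : ℕ} [NeZero N] (f : CuspForm (Gamma0 N) 2) {u ϖ : ℚ}
    (hΩu : W.realPeriodRat = u * plusPeriod f) (hϖ : (ϖ : ℝ) * W.realPeriodRat = plusPeriod f) :
    ϖ = u⁻¹ := by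
  have hΩpos : 0 < W.realPeriodRat := WeierstrassCurve.realPeriodRat_pos_holds W
  have hpf : plusPeriod f ≠ 0 := by
    intro h0
    rw [h0, mul_zero] at hΩu
    exact hΩpos.ne' hΩu
  have hmul : ((ϖ : ℝ) * u) * plusPeriod f = 1 * plusPeriod f := by
    rw [mul_assoc, ← hΩu, hϖ, one_mul]
  have hϖu : (ϖ : ℝ) * u = 1 := mul_right_cancel₀ hpf hmul
  have : (ϖ : ℝ) = (u : ℝ)⁻¹ := eq_inv_of_mul_eq_one_left hϖu
  exact_mod_cast this

/-- **(T2) ⟹ (T1): the b2b-bsdr2sha transcription of BCS Thm. 1.1.2 (b) implies the registry's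
(A148), granted the period comparison `Ω_E = u · Ω⁺_f`, `|u|_p = 1`** (Greenberg–Vatsal 2000
Rem. 3.4 / Mazur 1978 Cor. 4.1; named fact `realPeriodRat_eq_unit_mul_plusPeriod`). Proof: at
`p > 3` prime, `p ≥ 5`; (irr) ∧ (im) give surj(p) (`surj_of_irr_of_bigIm`), hence every `ρ̄_{E,p^n}`
onto (`serre_hasSurjectiveModNGaloisRep_pow_holds`), so (T2) applies at level `N_E` and gives
`ch_Λ X = (g)`, `ι g = L_p(f, α)`; the `ϖ` of (T1) is `u⁻¹` (`ratio_eq_inv_of_realPeriodRat_eq`), a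
`p`-adic unit, and rescaling the generator by `C(u)⁻¹ ∈ Λˣ` (`exists_span_eq_and_map_eq_C_inv_mul_iff`)
yields `ι g' = ϖ · L_p(f, α)` with the same ideal. [cite: BurungaleCastellaSkinner2025, Thm. 1.1.2 (b) (p. 2 of arXiv:2405.00270v2)]
[cite: GreenbergVatsal2000, §3, Remark 3.4] -/
theorem thm112b_of_charIdeal_eq_padicLFunction_integral
    (h : burungale_castella_skinner_charIdeal_eq_padicLFunction_integral)
    (hΩ : realPeriodRat_eq_unit_mul_plusPeriod) :
    thm112b_charIdeal_eq_padicLFunction_integral := by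
  intro W _ _ p _ hp hord hirr him κ γ hκ hγ hγ' _ f hf ϖ hϖ D
  have h5 : 5 ≤ p := five_le_of_three_lt_of_prime (Fact.out) hp
  have hsurj : Surj W p := surj_of_irr_of_bigIm W p hirr him
  have hsurjn : ∀ n : ℕ, W.HasSurjectiveModNGaloisRep (p ^ n : ℕ) :=
    serre_hasSurjectiveModNGaloisRep_pow_holds W p h5 hsurj
  obtain ⟨htors, g, hg, hI⟩ := h W p κ γ f h5 hord.1 hord.2 hirr hsurjn hκ hγ hγ' hf D
  obtain ⟨u, hu1, hΩu⟩ := hΩ W p h5 hord.1 hirr f hf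
  have hϖu : ϖ = u⁻¹ := ratio_eq_inv_of_realPeriodRat_eq W f hΩu hϖ
  refine ⟨htors, ?_⟩
  rw [hϖu, Rat.cast_inv]
  exact (exists_span_eq_and_map_eq_C_inv_mul_iff p hu1 _ _).2 ⟨g, hI, hg⟩

/-- **(T1) ⟹ (T2): the registry's (A148) implies the b2b-bsdr2sha transcription, granted the
period comparison (`realPeriodRat_eq_unit_mul_plusPeriod`), Carayol's level theorem
(`IsNewformOf.level_eq_conductorNorm`, at every level) and the kernel theorem "every `ρ̄_{E,p^n}`
onto ⟹ (im)"** (`hIm`; this is `Summit.BirchSwinnertonDyer.Rank1Residual.X9.bigIm_of_hasSurjectiveModNGaloisRep_pow`,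
a tree theorem on the `Summits` side which a `Literature` module cannot import — Summit-side users
pass it by name). Proof: Carayol puts the newform at level `N_E`; with `Ω_E = u · Ω⁺_f` take
`ϖ = u⁻¹` in (T1) (`u ≠ 0` as `|u|_p = 1`); rescale the generator by `C(u) ∈ Λˣ`
(`exists_span_eq_and_map_eq_C_inv_mul_iff`). [cite: BurungaleCastellaSkinner2025, Thm. 1.1.2 (b) (p. 2 of arXiv:2405.00270v2)]
[cite: GreenbergVatsal2000, §3, Remark 3.4] [cite: Carayol1986] -/
theorem charIdeal_eq_padicLFunction_integral_of_thm112b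
    (hB : thm112b_charIdeal_eq_padicLFunction_integral)
    (hΩ : realPeriodRat_eq_unit_mul_plusPeriod)
    (hC : ∀ {N : ℕ} [NeZero N], IsNewformOf.level_eq_conductorNorm (N := N))
    (hIm : ∀ (W : WeierstrassCurve ℚ) [W.IsElliptic] (p : ℕ) [Fact p.Prime],
      (∀ n : ℕ, W.HasSurjectiveModNGaloisRep (p ^ n : ℕ)) → BigIm W p) :
    burungale_castella_skinner_charIdeal_eq_padicLFunction_integral := by
  intro W _ _ p _ κ γ N _ f hp hgood hord hirr hsurj hκ hγ hγ' hf D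
  obtain rfl : N = W.conductorNorm ℤ := hC hf
  obtain ⟨u, hu1, hΩu⟩ := hΩ W p hp hgood hirr f hf
  have hu0 : (u : ℚ_[p]) ≠ 0 := fun h0 ↦ by simp [h0] at hu1
  have hu0' : u ≠ 0 := fun h0 ↦ hu0 (by simp [h0])
  have hϖ : ((u⁻¹ : ℚ) : ℝ) * W.realPeriodRat = plusPeriod f := by
    rw [hΩu, Rat.cast_inv, ← mul_assoc, inv_mul_cancel₀ (by exact_mod_cast hu0'), one_mul]
  obtain ⟨htors, g, hI, hg⟩ :=
    hB W p (by omega) ⟨hgood, hord⟩ hirr (hIm W p hsurj) κ γ hκ hγ hγ' f hf u⁻¹ hϖ D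
  refine ⟨htors, ?_⟩
  rw [Rat.cast_inv] at hg
  obtain ⟨g', hI', hg'⟩ := (exists_span_eq_and_map_eq_C_inv_mul_iff p hu1 _ _).1 ⟨g, hI, hg⟩
  exact ⟨g', hg', hI'⟩

end Literature.NumberTheory.EllipticCurves.BurungaleCastellaSkinner2025

end
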